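import Mathlib.Data.Fintype.Card
import Mathlib.Data.Finset.Card
import Mathlib.Algebra.BigOperators.Group.Finset.Basic
import Mathlib.Combinatorics.Enumerative.DoubleCounting
import Mathlib.Tactic
import HarnessLib

/-!
# Venture HSemireg — rigidity of the flat (2, 5) triangle-free design: no twins, the apex map, the pair `CD` is forced

Cell `pub-hsemireg`, widening group W5, seat w5-n7-1 (gen 12); files of record `widen/W5/N7-FEASIBILITY-w5n7.md` (N7F)
§3.9 (d) «MIN/MAX TABLE … flat-2, u = 5: [90, 90] vs 80 (ONE design up to the lex reduction — explicit enumeration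
enum_flat.py, independent of SAT: ×2 ACROSS METHODS …)» and the hand proof `widen/W5/PENTAGON-UNIQUENESS-w5n7g12.md`
(this seat: THEOREM (P5) — the flat (2, 5) triangle-free four-coordinate design is unique up to isomorphism; it is the
circulant design of the companion leg `FlatDesignPentagon`, so every torus graph is a 10-cycle and ΣN(C₄) = 90 always).
SETTING: levels `α, β, γ (, δ)` with 5 elements; 2-regular bipartite torus graphs given by neighbourhood maps with
transposes (`nAB/nBA`, …); triangle-free across every coordinate triple. What is kernel-checked (Steps 1–3 of the note;
the final identification with ℤ∕5-labels is NOT formalised):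

* STEP 1 — `no_twins` / `nAB_injective` (with `twin_transpose`, `false_of_twins_small`): no two levels of `A` have the
  same pair of `B`-neighbours; so every torus graph is a 10-CYCLE (a 2-regular bipartite graph on 5 + 5 is C₁₀ or
  C₄ ⊔ C₆, and a C₄ component is a pair of twins). Proof: twins `a₁, a₂` with `B`-pair `P` have disjoint `C`-shadows
  `CA = nAC a₁ ∪ nAC a₂`, `CB = ⋃_{b ∈ P} nBC b` (triangles); if `#CA = 2` a double count of the tori between `Pᶜ` and
  `CA` yields a torus `(b, c)` with `b ∉ P`, `c ∉ CA`, whose `A`-neighbourhoods are disjoint 2-subsets of the 3 levels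
  other than `a₁, a₂`; `#CB = 2` is the mirror (A ↔ B); else `3 + 3 ≤ 5`.
* STEP 2 — `apex`, `nCA_injective`: for every level `c` of `C` the `B`-neighbourhoods of its two `A`-neighbours cover
  exactly 3 levels, `nCB c` is their complement, and the two `A`-neighbours have exactly one common `B`-neighbour `b`
  (the APEX) with `nBA b = nCA c`; distinct levels of `C` have distinct `A`-pairs (apices). So `C` is a relabelling of
  `B` and `nCA`, `nCB` are determined by the 10-cycle `G_AB`.
* STEP 3 — `mem_nCD_iff_disjoint`: with a fourth coordinate, `d ∈ nCD c ⟺ nCA c ∩ nDA d = ∅`: the pair `CD` is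
  DETERMINED by the pairs through `A` (⇒ triangles; ⇐ at most two levels of `D` have an `A`-pair disjoint from `nCA c`
  — their apices lie outside the 3-level union — and the two `CD`-neighbours of `c` qualify).

HONEST FRAMING: finite combinatorics on 5 + 5 + 5 (+ 5) levels. Nothing in this file is a statement about a variety, a
sheaf or a Hodge class, and nothing here bears on HC / HC_CM / HC_AV.
-/

namespace Summit.Ventures.HSemireg.FlatPentagonTwinFree

open Finset

variable {α β γ : Type*}

/-- Twins transpose: if `a₁ ≠ a₂` have the same 2-set `P` of `B`-neighbours, then every `b ∈ P` has `A`-neighbourhood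
exactly `{a₁, a₂}`. -/
theorem twin_transpose [DecidableEq α] (nAB : α → Finset β) (nBA : β → Finset α) (cAB : ∀ a b, b ∈ nAB a ↔ a ∈ nBA b)
    (rBA : ∀ b, (nBA b).card = 2) (a₁ a₂ : α) (hne : a₁ ≠ a₂) (htwin : nAB a₁ = nAB a₂) (b : β)
    (hb : b ∈ nAB a₁) : nBA b = {a₁, a₂} := by
  symm
  apply eq_of_subset_of_card_le
  · intro a ha
    rw [mem_insert, mem_singleton] at ha
    rcases ha with rfl | rfl
    · exact (cAB _ b).1 hb
    · exact (cAB _ b).1 (htwin ▸ hb)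
  · rw [rBA, card_pair hne]

/-- The triangle hypothesis read from the level `c` (pairs `CA`, `AB`, third coordinate `B`). -/
theorem triangle_CAB (nAB : α → Finset β) (nAC : α → Finset γ) (nBC : β → Finset γ) (nCA : γ → Finset α)
    (nCB : γ → Finset β) (cAC : ∀ a c, c ∈ nAC a ↔ a ∈ nCA c) (cBC : ∀ b c, c ∈ nBC b ↔ b ∈ nCB c)
    (tABC : ∀ a b c, b ∈ nAB a → c ∈ nBC b → c ∉ nAC a) :
    ∀ c a b, a ∈ nCA c → b ∈ nAB a → b ∉ nCB c :=
  fun c a b ha hb hbc => tABC a b c hb ((cBC b c).2 hbc) ((cAC a c).2 ha)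

variable [Fintype α] [Fintype β] [Fintype γ] [DecidableEq α] [DecidableEq β] [DecidableEq γ]

/-- **The small case.** Twins `a₁ ≠ a₂` in `nAB` whose `C`-neighbourhoods together have only 2 levels are impossible
in a flat (2, 5) triangle-free three-coordinate system. (Then `nAC a₁ = nAC a₂ =: CA`; the levels of `CA` spend their
four `B`-edges outside the twin pair's `B`-pair `P`; the three `B`-levels outside `P` have six `C`-edges, so one meets a
`C`-level outside `CA`; that torus has both end-levels with two `A`-neighbours among the three `A`-levels other than
`a₁, a₂`, and triangle-freeness makes the two pairs disjoint: 4 ≤ 3.) -/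
theorem false_of_twins_small (hα : Fintype.card α = 5) (hβ : Fintype.card β = 5)
    (nAB : α → Finset β) (nBA : β → Finset α) (nAC : α → Finset γ) (nCA : γ → Finset α)
    (nBC : β → Finset γ) (nCB : γ → Finset β)
    (cAB : ∀ a b, b ∈ nAB a ↔ a ∈ nBA b) (cAC : ∀ a c, c ∈ nAC a ↔ a ∈ nCA c)
    (cBC : ∀ b c, c ∈ nBC b ↔ b ∈ nCB c)
    (rAB : ∀ a, (nAB a).card = 2) (rBA : ∀ b, (nBA b).card = 2) (rAC : ∀ a, (nAC a).card = 2)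
    (rCA : ∀ c, (nCA c).card = 2) (rBC : ∀ b, (nBC b).card = 2) (rCB : ∀ c, (nCB c).card = 2)
    (tABC : ∀ a b c, b ∈ nAB a → c ∈ nBC b → c ∉ nAC a)
    (a₁ a₂ : α) (hne : a₁ ≠ a₂) (htwin : nAB a₁ = nAB a₂) (hsmall : (nAC a₁ ∪ nAC a₂).card = 2) : False := by
  -- the C-neighbourhoods of the twins coincide with CA := nAC a₁ ∪ nAC a₂
  set CA := nAC a₁ ∪ nAC a₂ with hCA
  have hA1 : nAC a₁ = CA :=
    eq_of_subset_of_card_le subset_union_left (by rw [hsmall, rAC])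
  have hA2 : nAC a₂ = CA :=
    eq_of_subset_of_card_le subset_union_right (by rw [hsmall, rAC])
  set P := nAB a₁ with hP
  -- B-levels outside P have both A-neighbours ≠ a₁, a₂; C-levels outside CA likewise
  have hBA_out : ∀ b, b ∉ P → ∀ a ∈ nBA b, a ≠ a₁ ∧ a ≠ a₂ := by
    intro b hb a ha
    constructor
    · rintro rfl; exact hb ((cAB _ b).2 ha)
    · rintro rfl; exact hb (htwin ▸ (cAB _ b).2 ha)
  have hCA_out : ∀ c, c ∉ CA → ∀ a ∈ nCA c, a ≠ a₁ ∧ a ≠ a₂ := by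
    intro c hc a ha
    constructor
    · rintro rfl; exact hc (hA1 ▸ (cAC _ c).2 ha)
    · rintro rfl; exact hc (hA2 ▸ (cAC _ c).2 ha)
  -- count the C-edges of the B-levels outside P: six edge ends, of which the CA-levels absorb exactly four
  have hPcard : P.card = 2 := rAB a₁
  have hPc : (Pᶜ).card = 3 := by rw [card_compl, hPcard, hβ]
  -- there is a torus from Pᶜ to CAᶜ
  obtain ⟨b, hb, c, hc, hbc⟩ : ∃ b ∈ Pᶜ, ∃ c ∈ CAᶜ, c ∈ nBC b := by
    by_contra hno
    push Not at hno
    -- then every C-edge of a level b ∈ Pᶜ lands in CA: double count the tori between Pᶜ and CA (6 = … ≤ 4)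
    have hdc := Finset.sum_card_bipartiteAbove_eq_sum_card_bipartiteBelow (s := Pᶜ) (t := CA)
      (r := fun b c => c ∈ nBC b)
    have hL : ∀ b ∈ Pᶜ, (CA.bipartiteAbove (fun b c => c ∈ nBC b) b).card = 2 := by
      intro b hb
      have : CA.bipartiteAbove (fun b c => c ∈ nBC b) b = nBC b := by
        ext c
        simp only [bipartiteAbove, mem_filter]
        constructor
        · exact fun h => h.2
        · intro hc
          exact ⟨by_contra fun hcc => hno b hb c (mem_compl.2 hcc) hc, hc⟩
      rw [this, rBC]
    have hR : ∀ c ∈ CA, ((Pᶜ).bipartiteBelow (fun b c => c ∈ nBC b) c).card ≤ 2 := by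
      intro c _
      rw [← rCB c]
      exact card_le_card fun b hb => by
        simp only [bipartiteBelow, mem_filter] at hb
        exact (cBC b c).1 hb.2
    have h6 : ∑ b ∈ Pᶜ, (CA.bipartiteAbove (fun b c => c ∈ nBC b) b).card = 6 := by
      rw [sum_congr rfl hL, sum_const, hPc, smul_eq_mul]
    have h4 : ∑ c ∈ CA, ((Pᶜ).bipartiteBelow (fun b c => c ∈ nBC b) c).card ≤ 4 := by
      calc ∑ c ∈ CA, ((Pᶜ).bipartiteBelow (fun b c => c ∈ nBC b) c).card ≤ ∑ c ∈ CA, 2 := sum_le_sum hR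
        _ = 4 := by rw [sum_const, hsmall, smul_eq_mul]
    omega
  -- the torus (b, c): A-neighbourhoods of b and c are disjoint 2-subsets of the 3 levels other than a₁, a₂
  have hdisj : Disjoint (nBA b) (nCA c) := by
    rw [Finset.disjoint_left]
    intro a hab hac
    exact tABC a b c ((cAB a b).2 hab) hbc ((cAC a c).2 hac)
  have hsub : nBA b ∪ nCA c ⊆ ({a₁, a₂} : Finset α)ᶜ := by
    intro a ha
    rw [mem_compl, mem_insert, mem_singleton, not_or]
    rw [mem_union] at ha
    rcases ha with ha | ha
    · exact hBA_out b (mem_compl.1 hb) a ha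
    · exact hCA_out c (mem_compl.1 hc) a ha
  have := card_le_card hsub
  rw [card_union_of_disjoint hdisj, rBA, rCA, card_compl, card_pair hne, hα] at this
  omega

/-- **No twins in a flat (2, 5) triangle-free three-coordinate system**: two distinct levels of `A` never have the same
pair of `B`-neighbours. Equivalently (2-regular bipartite on 5 + 5) the torus graph `A–B` has no 4-cycle component,
i.e. it is a 10-cycle; by symmetry of the hypotheses the same holds for every ordered pair of coordinates. -/
theorem no_twins (hα : Fintype.card α = 5) (hβ : Fintype.card β = 5) (hγ : Fintype.card γ = 5)
    (nAB : α → Finset β) (nBA : β → Finset α) (nAC : α → Finset γ) (nCA : γ → Finset α)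
    (nBC : β → Finset γ) (nCB : γ → Finset β)
    (cAB : ∀ a b, b ∈ nAB a ↔ a ∈ nBA b) (cAC : ∀ a c, c ∈ nAC a ↔ a ∈ nCA c)
    (cBC : ∀ b c, c ∈ nBC b ↔ b ∈ nCB c)
    (rAB : ∀ a, (nAB a).card = 2) (rBA : ∀ b, (nBA b).card = 2) (rAC : ∀ a, (nAC a).card = 2)
    (rCA : ∀ c, (nCA c).card = 2) (rBC : ∀ b, (nBC b).card = 2) (rCB : ∀ c, (nCB c).card = 2)
    (tABC : ∀ a b c, b ∈ nAB a → c ∈ nBC b → c ∉ nAC a) (a₁ a₂ : α) (hne : a₁ ≠ a₂) :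
    nAB a₁ ≠ nAB a₂ := by
  intro htwin
  obtain ⟨b₁, b₂, hb, hP⟩ := card_eq_two.1 (rAB a₁)
  -- the two C-shadows of the twin pair are disjoint
  have hdisj : Disjoint (nAC a₁ ∪ nAC a₂) (nBC b₁ ∪ nBC b₂) := by
    rw [Finset.disjoint_left]
    intro c hcA hcB
    rw [mem_union] at hcA hcB
    have hb₁ : b₁ ∈ nAB a₁ := by rw [hP]; simp
    have hb₂ : b₂ ∈ nAB a₁ := by rw [hP]; simp
    rcases hcA with h1 | h2 <;> rcases hcB with k1 | k2
    · exact tABC a₁ b₁ c hb₁ k1 h1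
    · exact tABC a₁ b₂ c hb₂ k2 h1
    · exact tABC a₂ b₁ c (htwin ▸ hb₁) k1 h2
    · exact tABC a₂ b₂ c (htwin ▸ hb₂) k2 h2
  have hle : (nAC a₁ ∪ nAC a₂).card + (nBC b₁ ∪ nBC b₂).card ≤ 5 := by
    rw [← card_union_of_disjoint hdisj, ← hγ]
    exact card_le_univ _
  have hA2 : 2 ≤ (nAC a₁ ∪ nAC a₂).card := (rAC a₁).symm.le.trans (card_le_card subset_union_left)
  have hB2 : 2 ≤ (nBC b₁ ∪ nBC b₂).card := (rBC b₁).symm.le.trans (card_le_card subset_union_left)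
  by_cases hA : (nAC a₁ ∪ nAC a₂).card = 2
  · exact false_of_twins_small hα hβ nAB nBA nAC nCA nBC nCB cAB cAC cBC rAB rBA rAC rCA rBC rCB tABC a₁ a₂ hne
      htwin hA
  by_cases hB : (nBC b₁ ∪ nBC b₂).card = 2
  · -- the mirror case: b₁, b₂ are twins for nBA with common A-pair {a₁, a₂}
    have htwin' : nBA b₁ = nBA b₂ := by
      rw [twin_transpose nAB nBA cAB rBA a₁ a₂ hne htwin b₁ (by rw [hP]; simp),
        twin_transpose nAB nBA cAB rBA a₁ a₂ hne htwin b₂ (by rw [hP]; simp)]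
    exact false_of_twins_small hβ hα nBA nAB nBC nCB nAC nCA (fun b a => (cAB a b).symm) cBC cAC rBA rAB rBC
      rCB rAC rCA (fun b a c hab hac hcb => tABC a b c ((cAB a b).2 hab) hcb hac) b₁ b₂ hb htwin' hB
  omega

/-- The same statement as injectivity of the neighbourhood map `nAB` on the five levels of `A`. -/
theorem nAB_injective (hα : Fintype.card α = 5) (hβ : Fintype.card β = 5) (hγ : Fintype.card γ = 5)
    (nAB : α → Finset β) (nBA : β → Finset α) (nAC : α → Finset γ) (nCA : γ → Finset α)
    (nBC : β → Finset γ) (nCB : γ → Finset β)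
    (cAB : ∀ a b, b ∈ nAB a ↔ a ∈ nBA b) (cAC : ∀ a c, c ∈ nAC a ↔ a ∈ nCA c)
    (cBC : ∀ b c, c ∈ nBC b ↔ b ∈ nCB c)
    (rAB : ∀ a, (nAB a).card = 2) (rBA : ∀ b, (nBA b).card = 2) (rAC : ∀ a, (nAC a).card = 2)
    (rCA : ∀ c, (nCA c).card = 2) (rBC : ∀ b, (nBC b).card = 2) (rCB : ∀ c, (nCB c).card = 2)
    (tABC : ∀ a b c, b ∈ nAB a → c ∈ nBC b → c ∉ nAC a) : Function.Injective nAB :=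
  fun a₁ a₂ h => by_contra fun hne =>
    no_twins hα hβ hγ nAB nBA nAC nCA nBC nCB cAB cAC cBC rAB rBA rAC rCA rBC rCB tABC a₁ a₂ hne h

/-! ### Step 2 of the uniqueness (PENTAGON-UNIQUENESS-w5n7g12.md): the apex map -/

/-- **The apex.** In a flat (2, 5) triangle-free three-coordinate system, for every level `c` of `C`: the `B`-neighbourhoods
of its two `A`-neighbours cover exactly 3 levels of `B`, `nCB c` is the complement of that union, and the two
`A`-neighbours have exactly one common `B`-neighbour `b` — the APEX of `c` — with `nBA b = nCA c`. (Triangles keep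
`nCB c` off the union, so the union has ≤ 3 levels; no twins (`no_twins`) makes it ≥ 3.) -/
theorem apex (hα : Fintype.card α = 5) (hβ : Fintype.card β = 5) (hγ : Fintype.card γ = 5)
    (nAB : α → Finset β) (nBA : β → Finset α) (nAC : α → Finset γ) (nCA : γ → Finset α)
    (nBC : β → Finset γ) (nCB : γ → Finset β)
    (cAB : ∀ a b, b ∈ nAB a ↔ a ∈ nBA b) (cAC : ∀ a c, c ∈ nAC a ↔ a ∈ nCA c)
    (cBC : ∀ b c, c ∈ nBC b ↔ b ∈ nCB c)
    (rAB : ∀ a, (nAB a).card = 2) (rBA : ∀ b, (nBA b).card = 2) (rAC : ∀ a, (nAC a).card = 2)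
    (rCA : ∀ c, (nCA c).card = 2) (rBC : ∀ b, (nBC b).card = 2) (rCB : ∀ c, (nCB c).card = 2)
    (tABC : ∀ a b c, b ∈ nAB a → c ∈ nBC b → c ∉ nAC a) (c : γ) :
    ((nCA c).biUnion nAB).card = 3 ∧ nCB c = ((nCA c).biUnion nAB)ᶜ ∧ ∃ b, nBA b = nCA c := by
  have tCAB := triangle_CAB nAB nAC nBC nCA nCB cAC cBC tABC
  set U := (nCA c).biUnion nAB with hU
  -- nCB c avoids U
  have hsub : nCB c ⊆ Uᶜ := by
    intro b hb
    rw [mem_compl, hU, mem_biUnion]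
    rintro ⟨a, ha, hab⟩
    exact tCAB c a b ha hab hb
  have hU3 : U.card ≤ 3 := by
    have := card_le_card hsub
    rw [rCB, card_compl, hβ] at this
    omega
  -- the two A-neighbours of c are not twins, so U has at least 3 levels
  obtain ⟨a, a', hne, hca⟩ := card_eq_two.1 (rCA c)
  have haU : nAB a ⊆ U := by
    intro b hb; rw [hU, mem_biUnion]; exact ⟨a, by rw [hca]; simp, hb⟩
  have ha'U : nAB a' ⊆ U := by
    intro b hb; rw [hU, mem_biUnion]; exact ⟨a', by rw [hca]; simp, hb⟩
  have hnt : nAB a ≠ nAB a' :=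
    no_twins hα hβ hγ nAB nBA nAC nCA nBC nCB cAB cAC cBC rAB rBA rAC rCA rBC rCB tABC a a' hne
  have h3U : 3 ≤ U.card := by
    by_contra hlt
    push Not at hlt
    have h1 : nAB a = U := eq_of_subset_of_card_le haU (by rw [rAB]; omega)
    have h2 : nAB a' = U := eq_of_subset_of_card_le ha'U (by rw [rAB]; omega)
    exact hnt (h1.trans h2.symm)
  have hUeq : U.card = 3 := le_antisymm hU3 h3U
  refine ⟨hUeq, eq_of_subset_of_card_le hsub (by rw [card_compl, hUeq, hβ, rCB]), ?_⟩
  -- the apex: the unique common B-neighbour of a and a'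
  have hUnion : U = nAB a ∪ nAB a' := by
    rw [hU, hca, biUnion_insert, singleton_biUnion]
  have hinter : (nAB a ∩ nAB a').card = 1 := by
    have := card_union_add_card_inter (nAB a) (nAB a')
    rw [← hUnion, hUeq, rAB, rAB] at this
    omega
  obtain ⟨b, hb⟩ := card_eq_one.1 hinter
  refine ⟨b, ?_⟩
  have hb' : b ∈ nAB a ∩ nAB a' := by rw [hb]; exact mem_singleton_self b
  rw [mem_inter] at hb'
  rw [hca]
  symm
  apply eq_of_subset_of_card_le
  · intro x hx
    rw [mem_insert, mem_singleton] at hx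
    rcases hx with rfl | rfl
    · exact (cAB _ b).1 hb'.1
    · exact (cAB _ b).1 hb'.2
  · rw [rBA, card_pair hne]

/-- **The apex map is injective** (distinct levels of `C` have distinct apices): two levels of `C` with the same `A`-pair
would be twins for `nCA`, excluded by `no_twins` read on the triple `(C, A, B)`. Hence `c ↦ apex c` is a bijection
`C → B` and `nCA c`, `nCB c` are determined by it — Step 2 of the uniqueness. -/
theorem nCA_injective (hα : Fintype.card α = 5) (hβ : Fintype.card β = 5) (hγ : Fintype.card γ = 5)
    (nAB : α → Finset β) (nBA : β → Finset α) (nAC : α → Finset γ) (nCA : γ → Finset α)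
    (nBC : β → Finset γ) (nCB : γ → Finset β)
    (cAB : ∀ a b, b ∈ nAB a ↔ a ∈ nBA b) (cAC : ∀ a c, c ∈ nAC a ↔ a ∈ nCA c)
    (cBC : ∀ b c, c ∈ nBC b ↔ b ∈ nCB c)
    (rAB : ∀ a, (nAB a).card = 2) (rBA : ∀ b, (nBA b).card = 2) (rAC : ∀ a, (nAC a).card = 2)
    (rCA : ∀ c, (nCA c).card = 2) (rBC : ∀ b, (nBC b).card = 2) (rCB : ∀ c, (nCB c).card = 2)
    (tABC : ∀ a b c, b ∈ nAB a → c ∈ nBC b → c ∉ nAC a) : Function.Injective nCA :=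
  nAB_injective hγ hα hβ nCA nAC nCB nBC nAB nBA (fun c a => (cAC a c).symm) (fun c b => (cBC b c).symm) cAB
    rCA rAC rCB rBC rAB rBA (triangle_CAB nAB nAC nBC nCA nCB cAC cBC tABC)

section FourCoordinates

variable {δ : Type*} [Fintype δ] [DecidableEq δ]

/-- **Step 3 of the uniqueness: the pair `CD` is determined by the pairs through `A`.** In a flat (2, 5) triangle-free
four-coordinate design, `d ∈ nCD c` if and only if the `A`-pairs `nCA c` and `nDA d` are disjoint. (⇒: a common
`A`-neighbour closes a triangle. ⇐: the apices of the levels of `D` are pairwise distinct, and only the two levels of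
`B` outside the 3-level union `⋃_{a ∈ nCA c} nAB a` have `A`-pair disjoint from `nCA c`; so at most two levels of `D`
qualify, and the two `C D`-neighbours of `c` do. Neither the transpose `nDC` nor the `D`-side degree of the
pair `CD` is needed.) -/
theorem mem_nCD_iff_disjoint (hα : Fintype.card α = 5) (hβ : Fintype.card β = 5) (hγ : Fintype.card γ = 5)
    (hδ : Fintype.card δ = 5)
    (nAB : α → Finset β) (nBA : β → Finset α) (nAC : α → Finset γ) (nCA : γ → Finset α)
    (nAD : α → Finset δ) (nDA : δ → Finset α) (nBC : β → Finset γ) (nCB : γ → Finset β)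
    (nBD : β → Finset δ) (nDB : δ → Finset β) (nCD : γ → Finset δ)
    (cAB : ∀ a b, b ∈ nAB a ↔ a ∈ nBA b) (cAC : ∀ a c, c ∈ nAC a ↔ a ∈ nCA c)
    (cAD : ∀ a d, d ∈ nAD a ↔ a ∈ nDA d) (cBC : ∀ b c, c ∈ nBC b ↔ b ∈ nCB c)
    (cBD : ∀ b d, d ∈ nBD b ↔ b ∈ nDB d)
    (rAB : ∀ a, (nAB a).card = 2) (rBA : ∀ b, (nBA b).card = 2) (rAC : ∀ a, (nAC a).card = 2)
    (rCA : ∀ c, (nCA c).card = 2) (rAD : ∀ a, (nAD a).card = 2) (rDA : ∀ d, (nDA d).card = 2)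
    (rBC : ∀ b, (nBC b).card = 2) (rCB : ∀ c, (nCB c).card = 2) (rBD : ∀ b, (nBD b).card = 2)
    (rDB : ∀ d, (nDB d).card = 2) (rCD : ∀ c, (nCD c).card = 2)
    (tABC : ∀ a b c, b ∈ nAB a → c ∈ nBC b → c ∉ nAC a)
    (tABD : ∀ a b d, b ∈ nAB a → d ∈ nBD b → d ∉ nAD a)
    (tACD : ∀ a c d, c ∈ nAC a → d ∈ nCD c → d ∉ nAD a) (c : γ) (d : δ) :
    d ∈ nCD c ↔ Disjoint (nCA c) (nDA d) := by
  -- ⇒ for every d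
  have himp : ∀ d', d' ∈ nCD c → Disjoint (nCA c) (nDA d') := by
    intro d' hd'
    rw [Finset.disjoint_left]
    intro a hac had
    exact tACD a c d' ((cAC a c).2 hac) hd' ((cAD a d').2 had)
  refine ⟨himp d, fun hdisj => ?_⟩
  -- the qualifying levels T of D and the qualifying apices S of B
  obtain ⟨hU3, -, -⟩ := apex hα hβ hγ nAB nBA nAC nCA nBC nCB cAB cAC cBC rAB rBA rAC rCA rBC rCB tABC c
  set U := (nCA c).biUnion nAB with hU
  set T := univ.filter (fun d' : δ => Disjoint (nCA c) (nDA d')) with hT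
  -- apices of D-levels (the triple (A, B, D))
  have apexD : ∀ d' : δ, ∃ b, nBA b = nDA d' := fun d' =>
    (apex hα hβ hδ nAB nBA nAD nDA nBD nDB cAB cAD cBD rAB rBA rAD rDA rBD rDB tABD d').2.2
  have injD : Function.Injective nDA :=
    nCA_injective hα hβ hδ nAB nBA nAD nDA nBD nDB cAB cAD cBD rAB rBA rAD rDA rBD rDB tABD
  -- T has at most #Uᶜ = 2 elements: d' ↦ its apex lands in Uᶜ, injectively
  have hTle : T.card ≤ (Uᶜ).card := by
    refine card_le_card_of_forall_subsingleton (fun d' b => nBA b = nDA d') (fun d' hd' => ?_) (fun b hb => ?_)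
    · obtain ⟨b, hb⟩ := apexD d'
      refine ⟨b, ?_, hb⟩
      rw [hT, mem_filter] at hd'
      rw [mem_compl, hU, mem_biUnion]
      rintro ⟨a, ha, hab⟩
      -- a ∈ nCA c and a ∈ nBA b = nDA d': contradicts the disjointness defining T
      exact Finset.disjoint_left.1 hd'.2 ha (hb ▸ (cAB a b).1 hab)
    · intro d₁ hd₁ d₂ hd₂
      simp only [Set.mem_setOf_eq] at hd₁ hd₂
      exact injD (hd₁.2.symm.trans hd₂.2)
  have hUc : (Uᶜ).card = 2 := by rw [card_compl, hU3, hβ]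
  -- nCD c ⊆ T with two elements, so nCD c = T ∋ d
  have hsub : nCD c ⊆ T := fun d' hd' => by
    rw [hT, mem_filter]; exact ⟨mem_univ _, himp d' hd'⟩
  have heq : nCD c = T := eq_of_subset_of_card_le hsub (by rw [rCD]; omega)
  rw [heq, hT, mem_filter]
  exact ⟨mem_univ _, hdisj⟩

end FourCoordinates

end Summit.Ventures.HSemireg.FlatPentagonTwinFree
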